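import Literature.Computability.Cryptography.KyberCPAPKE
import Literature.Computability.Cryptography.MLKEMCompression
import Literature.Computability.Cryptography.RingLWRHardness
import Literature.Computability.Cryptography.DilithiumMLWEMSIS
import HarnessLib

/-!
# Kyber.CPAPKE / K-PKE is `(1 − δ)`-correct (Bos et al. 2018, Theorem 1): the decryption-noise
# identity, the decoding threshold, and the rigorous part of the `δ` bound

Topic `Computability/Cryptography`. J. Bos, L. Ducas, E. Kiltz, T. Lepoint, V. Lyubashevsky,
J. M. Schanck, P. Schwabe, G. Seiler, D. Stehlé, *CRYSTALS – Kyber: a CCA-secure module-lattice-based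
KEM*, EuroS&P 2018, §3 "Kyber's IND-CPA-secure encryption", verbatim:

> "**Correctness.** We show below the correctness of the encryption scheme described in Algorithms 1
> to 3. … **Theorem 1.** Let `k` be a positive integer parameter. Let `s, e, r, e₁, e₂` be random
> variables that have the same distribution as in Algorithms 1 and 2. Also, let `c_t ← ψ^k_{d_t}`,
> `c_u ← ψ^k_{d_u}`, `c_v ← ψ_{d_v}` be distributed according to the distribution `ψ` defined as follows:
> Let `ψ^k_d` be the following distribution over `R`: 1: Choose uniformly-random `y ← R^k`; 2: return
> `(y − Decompress_q(Compress_q(y, d), d)) mod± q`. Denote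
> `δ = Pr[‖eᵀr + e₂ + c_v − sᵀe₁ + c_tᵀr − sᵀc_u‖_∞ ≥ ⌈q/4⌋]`. Then Kyber.CPA is `(1 − δ)`-correct."
> "**Proof.** The value of `t` in line [2] of Algorithm 2 is `t = … = As + e + c_t` for some `c_t ∈ R^k`.
> The value of `u` in Algorithm 3 is `u = … = Aᵀr + e₁ + c_u` … [and] `v = … = tᵀr + e₂ + ⌈q/2⌋·m + c_v`
> … for some `c_v ∈ R`. In all of the above, we can safely assume that the values `c_t`, `c_u`, and
> `c_v` are distributed according to the distribution `ψ` defined in the theorem statement. The reason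
> is that all of these are of the form `y − Decompress_q(Compress_q(y, d), d) mod± q` where `y` is
> pseudo-random based on the hardness of Module-LWE. Using the above, we obtain
> `v − sᵀu = eᵀr + e₂ + ⌈q/2⌋·m + c_v + c_tᵀr − sᵀe₁ − sᵀc_u`. If
> `‖eᵀr + e₂ + c_v + c_tᵀr − sᵀe₁ − sᵀc_u‖_∞ < ⌈q/4⌋`, then we can write `v − sᵀu = w + ⌈q/2⌋·m` where
> `‖w‖_∞ < ⌈q/4⌋`. Define `m′ = Compress_q(v − sᵀu, 1)`. We then know that
> `⌈q/4⌋ ≥ ‖v − sᵀu − ⌈q/2⌋·m′‖_∞ = ‖w + ⌈q/2⌋·m − ⌈q/2⌋·m′‖_∞`. By the triangle inequality and the fact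
> that `‖w‖_∞ < ⌈q/4⌋`, we obtain `‖⌈q/2⌋·(m − m′)‖_∞ < 2·⌈q/4⌋`, which (for all odd `q`) implies that
> `m = m′`, and proves the correctness of Kyber.CPA." [BosEtAl2018Kyber, §3 Theorem 1 and its proof]

with `(1 − δ)`-correctness as in §2.1 ("Following [HHK17] …"): `E[max_{m ∈ M} Pr[Dec(sk, c) ≠ m |
c ← Enc(pk, m)]] ≤ δ`, "where the expectation is taken over `(pk, sk) ← KeyGen` and the probability is
taken over the random coins of `Enc`" [HofheinzHovelmannsKiltz2017, §2.1]
[BosEtAl2018Kyber, §2.1]. In Kyber v2–v3.02 and in ML-KEM (FIPS 203) the public key `t` is no longer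
compressed (`c_t = 0`); the CRYSTALS-Kyber specification v3.02 computes its Table 1 failure
probabilities `δ` from this theorem (§1.4, p. 11: "The failure probability `δ` is computed with the help
of the `Kyber.py` Python script … For the theoretical justification of the script see [24 = Bos et al.,
Theorem 1]") [AvanziEtAl2021KyberSpec, §1.4 p. 11], and Barbosa–Kannwischer–Lim–Schwabe–Strub (CCS
2025, §3.2 "Correctness Analysis", EasyCrypt-verified) restate the ML-KEM form: "A simple algebraic
argument permits showing that the noise that remains added to the message `m` is given by the
expression assigned to `ñ` in the figure [`ñ = ⟨e, r⟩ − ⟨s, e₁⟩ − ⟨s, c_u⟩ + e₂ + c_v`], and `⌊q/4⌋ − 1`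
is the maximum noise value above which a decoding error can occur in the message recovery. Note that
the noise expression includes two terms `c_u` and `c_v` that capture the inaccuracy introduced by
encoding ciphertexts via rounding …: these are expressed as additive noise, each of them defined as the
difference between the original value and the decoded value." They also record (§3.2.1) that the step
"we can safely assume that `c_t`, `c_u`, `c_v` are distributed according to `ψ`" is a HEURISTIC
("[Bos et al.] … simply assumes that one can take the probability of the event defined in the
experiment in Figure 3 (right) as an upper-bound for the correctness error. The assumption here is that
`(u, v)` are taken to be values sampled uniformly at random"), and (§3.2.2 "Removing the adversary")
that the adversary's/message's only influence on the noise is through `c_v`, "so one can just consider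
the worst case value of `c_v`". [BarbosaEtAl2025CorrectnessBounds, §3.2, §3.2.1, §3.2.2]

## What is formalised (following the printed proof)

All of it sits on the algebraic skeleton `KyberPKE.keyGen / encDet / enc₂ / dec` of `KyberCPAPKE.lean`
(any commutative ring `R`, rank `k`; ML-KEM: `R = R_q = ℤ_3329[X]/(X^256 + 1)`):

* **Round trips and error terms.** `KyberPKE.RoundTrips R k` = the three maps
  `y ↦ Decompress_q(Compress_q(y, d), d)` for `t` (`d_t`; the identity when `t` is transmitted exactly),
  `u` (`d_u`), `v` (`d_v`) — arbitrary self-maps, since only the round trip enters decryption;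
  `KyberPKE.pkRT` (the key the encryptor uses: `t′ = t + c_t`), `KyberPKE.ctRT` (the ciphertext the
  decryptor sees: `(u + c_u, v + c_v)`), `KyberPKE.tErr / uErr / vErr` (`c_t, c_u, c_v`, "the
  difference between the original value and the decoded value"), `KyberPKE.errOf` (`e = t − As`
  recovered from `(pk, sk)`), `KyberPKE.ct` (the ciphertext of `μ` under coins `(r, e₁, e₂)`).
* **The noise and the decryption equation** (the "simple algebraic argument"): `KyberPKE.noise ρ pk s μ
  r e₁ e₂ = eᵀr + e₂ + c_v − sᵀe₁ + c_tᵀr − sᵀc_u` in the printed order, and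
  **`KyberPKE.dec_ctRT_ct`**: `v′ − sᵀu′ = μ + noise` — for EVERY key pair, message and coin outcome.
  `KyberPKE.noise_eq_noise₀_add`: `noise = noise₀ + c_v` with `noise₀` independent of the message
  (Barbosa et al. §3.2.2).
* **The decoding threshold** (the "`m = m′`" step, integer arithmetic, every modulus `q`):
  **`MLKEM.compress_one_decompress_one_add`**: `Compress_q(Decompress_q(m, 1) + w, 1) = m` for
  `m ∈ {0, 1}` whenever `4·|w mod± q| + 2 < q`; for odd `q` this hypothesis fails exactly when
  `|w mod± q| ≥ ⌈q/4⌋ = ⌊(q + 2)/4⌋` (`MLKEM.not_lt_iff_threshold_le`, `MLKEM.round_quarter_eq`), the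
  printed threshold (`= ⌊q/4⌋` when `q ≡ 1 (mod 4)`, as for `q = 3329, 7681`; Barbosa et al.'s
  "`⌊q/4⌋ − 1` is the maximum [safe] noise value"); `MLKEM.threshold_sharp_mlkem`: at `q = 3329` the
  noise value `832 = ⌈q/4⌋` does produce a decoding error (kernel-checked), so the bound is sharp.
  (The proof here is a direct case analysis on the message bit and on the wrap-around of
  `⌈q/2⌋·m + w` modulo `q`, in place of the printed triangle-inequality step; it needs no hypothesis on
  `q` beyond `4|w mod± q| + 2 < q`.)
* **Coefficient-wise codec over `R_q = 𝓞_K/q` in a `ℤ`-basis `b`** (Kyber §1.1: Compress/Decompress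
  act on each coefficient): `MLKEM.decompressRq` (new; `MLKEM.compressRq` is the tree's), the round
  trip `MLKEM.roundTripRq b q d` with `‖roundTripRq x − x‖_∞ ≤ B_q = ⌈q/2^{d+1}⌋`
  (`MLKEM.coeffSupNorm_roundTripRq_sub_le`, from the tree's `abs_compressErr_le`), the message codec
  `MLKEM.encodeMsg b q m = Decompress_q(m, 1)` / decode `= compressRq b q 1`, and the good-noise event
  `MLKEM.GoodNoise b q w :⇔ 4‖w‖_∞ + 2 < q` (`‖·‖_∞` = the tree's `RingLWE.coeffSupNorm`);
  **`MLKEM.compressRq_one_encodeMsg_add`**: `Compress_q(Decompress_q(m, 1) + w, 1) = m` under it.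
* **Correctness, deterministic form** — **`MLKEM.kpke_decode_eq`**: for every key pair `(pk, s)`, every
  message `m ∈ {0,1}^n`, all coins `(r, e₁, e₂)` and ANY round trips `ρ`:
  `GoodNoise(noise) → Compress_q(v′ − sᵀu′, 1) = m`; printed contrapositive for odd `q`
  **`MLKEM.threshold_le_coeffSupNorm_noise_of_ne`**: a decryption error forces `‖w‖_∞ ≥ ⌈q/4⌋`.
* **Correctness, probabilistic form.** `KyberPKE.coins χ₁ χ₂` (`r ← χ₁^k`, `e₁ ← χ₂^k`, `e₂ ← χ₂`, the
  two widths of Kyber §1.4 — one law when `χ₁ = χ₂`), `KyberPKE.failProb` (= `Pr_coins[Dec(sk, Enc(pk,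
  m)) ≠ m]`; `failProb_eq_enc₂` ties it to the tree's `KyberPKE.enc₂`), **`KyberPKE.correctnessError`**
  `= E_{(pk,sk) ← KeyGen}[max_m failProb]` (the printed `δ`-functional), `KyberPKE.noiseFailProb /
  noiseError` (the same functional of the event "noise not good"), and
  **`KyberPKE.correctnessError_le_noiseError`** (any codec with a decoding criterion) /
  **`MLKEM.kpke_correctnessError_le`**: `δ(K-PKE) ≤ E_{keys}[max_m Pr_coins[¬Good(noise(m))]]` — the
  rigorous content of Theorem 1 (event inclusion, with the TRUE `c_u, c_v`). The message-free bound of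
  Barbosa et al. §3.2.2: **`KyberPKE.correctnessError_le_noise₀`** /
  **`MLKEM.kpke_correctnessError_le_noise₀`**: `δ(K-PKE) ≤ Pr_{keys, coins}[4(‖noise₀‖_∞ + B_{d_v}) + 2
  ≥ q]`, a genuine probability with no maximum over messages.
* **ML-KEM numbers** (`q = 3329`): threshold `⌈q/4⌋ = 832` (`MLKEM.threshold_mlkem`), `B_{d_v} = 104`
  at `d_v = 4` (ML-KEM-512/768) and `52` at `d_v = 5` (ML-KEM-1024) (`MLKEM.bdv_mlkem768`,
  `MLKEM.bdv_mlkem1024`), and the instance statements `MLKEM.mlkem_decode_eq` /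
  `MLKEM.mlkem_correctnessError_le` over `R_q = 𝓞(ℚ(ζ_512))/3329` with the laws `D_{η₁}, D_{η₂}`.

NOT formalised: the replacement of `(c_t, c_u, c_v)` by INDEPENDENT `ψ`-distributed variables ("we can
safely assume …") — it is a heuristic, not a theorem (Barbosa et al. §3.2.1; their provable substitute
§3.2.3 splits the event and pays an MLWE advantage for the `c_u` part), so the number `δ = 2^{−139}` of
Kyber's Table 1 is not claimed here; and the FO-level consequences (Kyber Thms 2–3, HHK17) — no ROM
vocabulary in the tree.

## References

* J. Bos, L. Ducas, E. Kiltz, T. Lepoint, V. Lyubashevsky, J. M. Schanck, P. Schwabe, G. Seiler,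
  D. Stehlé, *CRYSTALS – Kyber: a CCA-secure module-lattice-based KEM*, 2018 IEEE EuroS&P, 353–367,
  doi 10.1109/EuroSP.2018.00032 (ePrint 2017/634): §2.1 (`(1−δ)`-correct), §2.2 (`mod±`, `⌈·⌋`,
  `‖·‖_∞`, Compress/Decompress), §3 Algorithms 1–3, Theorem 1 and proof. Held as
  paper:doi-10-1109-eurosp-2018-00032 (p0006–p0008, p0011) and, with the displayed formulas, as the
  authors' version kyber-20180226.pdf = galaxy pdf:-1617530668336693520 (p0006, p0010–p0011).
  [BosEtAl2018Kyber]
* M. Barbosa, M. J. Kannwischer, T. Lim, P. Schwabe, P.-Y. Strub, *Formally Verified Correctness Bounds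
  for Lattice-Based Cryptography*, ACM CCS 2025, 156–169, doi 10.1145/3719027.3765218: §2.1 (Fig. 1,
  `δ`-correctness game), §2.2 (K-PKE Algorithms 1–3), §3.2 (Fig. 3, the noise expression `ñ`, threshold
  `⌊q/4⌋ − 1`), §3.2.1 (the heuristic), §3.2.2 (removing the adversary: worst-case `c_v`). Held as
  paper:doi-10-1145-3719027-3765218 (p0006, p0007, p0012–p0015). [BarbosaEtAl2025CorrectnessBounds]
* D. Hofheinz, K. Hövelmanns, E. Kiltz, *A modular analysis of the Fujisaki–Okamoto transformation*,
  TCC 2017-I, LNCS 10677, §2.1 (`δ`-correct: `E[max_m Pr[Dec(sk, c) ≠ m | c ← Enc(pk, m)]] ≤ δ`).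
  [HofheinzHovelmannsKiltz2017]
* R. Avanzi et al., *CRYSTALS-Kyber Algorithm Specifications and Supporting Documentation* v3.02
  (2021): §1 Algorithms 4–6 (`v := tᵀr + e₂ + Decompress_q(m, 1)`, `m := Compress_q(v − sᵀu, 1)`),
  §1.1 (Compress/Decompress coefficient-wise, `B_q`), §1.4 p. 11 (δ via [24, Thm 1]; `η₁` for `s, e, r`,
  `η₂` for `e₁, e₂`). Held as paper:url-5bd2326281fb. [AvanziEtAl2021KyberSpec]
* NIST FIPS 203 (2024), §4.2.1 eqs (4.7)/(4.8) (Compress_d / Decompress_d). [NISTFIPS203]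
-/

noncomputable section

open scoped ENNReal

namespace Literature.Computability.Cryptography

/-! ### A. Round trips, the decryption noise and the decryption equation (any commutative ring) -/

namespace KyberPKE

variable {R : Type} [CommRing R] (k : ℕ)

/-- The three compression ROUND TRIPS `y ↦ Decompress_q(Compress_q(y, d), d)` of Kyber: on the public-key
vector `t` (width `d_t` in Bos et al.'s Algorithm 1, l. 4 / Algorithm 2, l. 2; the identity in Kyber v2+ and
ML-KEM, where `t` is sent exactly), on the ciphertext part `u` (`d_u`) and on `v` (`d_v`). Arbitrary
self-maps: only the round trip enters decryption. [cite: BosEtAl2018Kyber, §3 Algorithms 1–3 (Compress_q(·, d_t / d_u / d_v) and Decompress_q)] -/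
structure RoundTrips (R : Type) (k : ℕ) where
  /-- `t ↦ Decompress_q(Compress_q(t, d_t), d_t)` (identity if the public key is not compressed). -/
  t : (Fin k → R) → (Fin k → R)
  /-- `u ↦ Decompress_q(Compress_q(u, d_u), d_u)`. -/
  u : (Fin k → R) → (Fin k → R)
  /-- `v ↦ Decompress_q(Compress_q(v, d_v), d_v)`. -/
  v : R → R

/-- No compression anywhere: all three round trips the identity (the bare skeleton of `KyberCPAPKE.lean`).
[cite: BosEtAl2018Kyber, §3 ("Security of a modified scheme": the scheme without compressing t)] -/
protected def RoundTrips.id (R : Type) (k : ℕ) : RoundTrips R k := ⟨id, id, id⟩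

/-- The error vector `e = t − As` determined by a public key `(A, t)` and the secret `s` (Algorithm 1:
`t := As + e`). [cite: BosEtAl2018Kyber, §3 Algorithm 1 ("t := Compress_q(As + e, d_t)")] -/
def errOf (pk : PubKey R k) (s : Fin k → R) : Fin k → R := fun i ↦ (pk i).2 - (pk i).1 ⬝ᵥ s

/-- For an honestly generated key `(A, As + e)`, `errOf` recovers `e`. [cite: BosEtAl2018Kyber, §3 Algorithm 1] -/
theorem errOf_eq_of_pk (pk : PubKey R k) (s e : Fin k → R)
    (hpk : ∀ i, (pk i).2 = (pk i).1 ⬝ᵥ s + e i) : errOf k pk s = e := by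
  funext i
  simp [errOf, hpk]

/-- The public key as the ENCRYPTOR uses it: `(A, t′)` with `t′ = Decompress_q(Compress_q(t, d_t), d_t)
= ρ.t t` (Algorithm 2, l. 2). [cite: BosEtAl2018Kyber, §3 Algorithm 2 ("t := Decompress_q(t, d_t)")] -/
def pkRT (ρ : RoundTrips R k) (pk : PubKey R k) : PubKey R k := fun i ↦ ((pk i).1, ρ.t (tvec k pk) i)

/-- `c_t := t′ − t` ("for some `c_t ∈ R^k`"). [cite: BosEtAl2018Kyber, §3 proof of Thm 1 ("t = As + e + c_t")] -/
def tErr (ρ : RoundTrips R k) (pk : PubKey R k) : Fin k → R := ρ.t (tvec k pk) - tvec k pk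

/-- The ciphertext as the DECRYPTOR sees it after decompression: `(u′, v′) = (ρ.u u, ρ.v v)`
(Algorithm 3, ll. 1–2). [cite: BosEtAl2018Kyber, §3 Algorithm 3 ("u := Decompress_q(u, d_u)", "v := Decompress_q(v, d_v)")] -/
def ctRT (ρ : RoundTrips R k) (c : Cipher R k) : Cipher R k := (ρ.u c.1, ρ.v c.2)

/-- `c_u := u′ − u` ("for some `c_u ∈ R^k`"; Barbosa et al.: "the difference between the original value and
the decoded value"). [cite: BosEtAl2018Kyber, §3 proof of Thm 1 ("u = Aᵀr + e₁ + c_u")] [cite: BarbosaEtAl2025CorrectnessBounds, §3.2 (c_u as additive noise)] -/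
def uErr (ρ : RoundTrips R k) (c : Cipher R k) : Fin k → R := ρ.u c.1 - c.1

/-- `c_v := v′ − v` ("for some `c_v ∈ R`"). [cite: BosEtAl2018Kyber, §3 proof of Thm 1 ("v = tᵀr + e₂ + ⌈q/2⌋·m + c_v")] [cite: BarbosaEtAl2025CorrectnessBounds, §3.2 (c_v as additive noise)] -/
def vErr (ρ : RoundTrips R k) (c : Cipher R k) : R := ρ.v c.2 - c.2

/-- The (uncompressed) ciphertext `(u, v) = (Aᵀr + e₁, t′ᵀr + e₂ + μ)` of the encoded message `μ`
(`= ⌈q/2⌋·m`) under the coins `(r, e₁, e₂)`, computed with the decompressed public key `t′`.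
[cite: BosEtAl2018Kyber, §3 Algorithm 2 (ll. 2–6)] -/
def ct (ρ : RoundTrips R k) (pk : PubKey R k) (μ : R) (r e₁ : Fin k → R) (e₂ : R) : Cipher R k :=
  encDet k (pkRT k ρ pk) μ r e₁ e₂

/-- The `u`-part of the ciphertext does not involve the message (nor `t`): `u = Aᵀr + e₁`.
[cite: BosEtAl2018Kyber, §3 Algorithm 2 ("u := Compress_q(Aᵀr + e₁, d_u)")] -/
theorem ct_fst (ρ : RoundTrips R k) (pk : PubKey R k) (μ : R) (r e₁ : Fin k → R) (e₂ : R) :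
    (ct k ρ pk μ r e₁ e₂).1 = fun j ↦ col k pk j ⬝ᵥ r + e₁ j := rfl

/-- **The decryption noise** `w = eᵀr + e₂ + c_v − sᵀe₁ + c_tᵀr − sᵀc_u` of Theorem 1, in the printed
order, for the key pair `(pk, s)` (`e = errOf pk s`), encoded message `μ`, coins `(r, e₁, e₂)` and round
trips `ρ` (`c_t, c_u, c_v` the ACTUAL round-trip errors of this key and this ciphertext). With `ρ.t = id`
(`c_t = 0`) this is Barbosa et al.'s `ñ = ⟨e, r⟩ − ⟨s, e₁⟩ − ⟨s, c_u⟩ + e₂ + c_v`.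
[cite: BosEtAl2018Kyber, §3 Thm 1 (δ = Pr[‖eᵀr + e₂ + c_v − sᵀe₁ + c_tᵀr − sᵀc_u‖_∞ ≥ ⌈q/4⌋])] [cite: BarbosaEtAl2025CorrectnessBounds, §3.2 Fig. 3 (ñ)] -/
def noise (ρ : RoundTrips R k) (pk : PubKey R k) (s : Fin k → R) (μ : R) (r e₁ : Fin k → R) (e₂ : R) :
    R :=
  errOf k pk s ⬝ᵥ r + e₂ + vErr k ρ (ct k ρ pk μ r e₁ e₂) - s ⬝ᵥ e₁ + tErr k ρ pk ⬝ᵥ r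
    - s ⬝ᵥ uErr k ρ (ct k ρ pk μ r e₁ e₂)

/-- The message-independent part of the noise, `w₀ = eᵀr + e₂ − sᵀe₁ + c_tᵀr − sᵀc_u` (everything but
`c_v`; `u`, hence `c_u`, does not involve the message — Barbosa et al. §3.2.2: "the adversary's influence
in the outcome of the experiment is limited to choosing `c_v`", their `ñ′ := ⟨e, r⟩ − ⟨s, e₁⟩ − ⟨s, c_u⟩ +
e₂`). [cite: BarbosaEtAl2025CorrectnessBounds, §3.2.2 (ñ′)] -/
def noise₀ (ρ : RoundTrips R k) (pk : PubKey R k) (s : Fin k → R) (r e₁ : Fin k → R) (e₂ : R) : R :=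
  errOf k pk s ⬝ᵥ r + e₂ - s ⬝ᵥ e₁ + tErr k ρ pk ⬝ᵥ r - s ⬝ᵥ uErr k ρ (ct k ρ pk 0 r e₁ e₂)

/-- `c_u` does not depend on the message. [cite: BarbosaEtAl2025CorrectnessBounds, §3.2.2] -/
theorem uErr_ct_eq (ρ : RoundTrips R k) (pk : PubKey R k) (μ : R) (r e₁ : Fin k → R) (e₂ : R) :
    uErr k ρ (ct k ρ pk μ r e₁ e₂) = uErr k ρ (ct k ρ pk 0 r e₁ e₂) := rfl

/-- `w = w₀ + c_v`. [cite: BarbosaEtAl2025CorrectnessBounds, §3.2.2 (ñ = ñ′ + c_v)] -/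
theorem noise_eq_noise₀_add (ρ : RoundTrips R k) (pk : PubKey R k) (s : Fin k → R) (μ : R)
    (r e₁ : Fin k → R) (e₂ : R) :
    noise k ρ pk s μ r e₁ e₂ = noise₀ k ρ pk s r e₁ e₂ + vErr k ρ (ct k ρ pk μ r e₁ e₂) := by
  unfold noise noise₀
  rw [uErr_ct_eq k ρ pk μ r e₁ e₂]
  ring

/-- **The decryption equation of Theorem 1** ("Using the above, we obtain `v − sᵀu = eᵀr + e₂ + c_v −
sᵀe₁ + c_tᵀr − sᵀc_u + ⌈q/2⌋·m`"): for EVERY key pair `(pk, s)`, encoded message `μ`, coins and round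
trips, the decryptor's `v′ − sᵀu′` equals `μ +` the noise. The "simple algebraic argument" of Barbosa
et al. §3.2. [cite: BosEtAl2018Kyber, §3 proof of Thm 1 (v − sᵀu = w + ⌈q/2⌋·m)] [cite: BarbosaEtAl2025CorrectnessBounds, §3.2 (noise added to the message)] -/
theorem dec_ctRT_ct (ρ : RoundTrips R k) (pk : PubKey R k) (s : Fin k → R) (μ : R)
    (r e₁ : Fin k → R) (e₂ : R) :
    dec k s (ctRT k ρ (ct k ρ pk μ r e₁ e₂)) = μ + noise k ρ pk s μ r e₁ e₂ := by
  -- the encryptor's key is `(A, A s + (e + c_t))`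
  have hpk : ∀ i, (pkRT k ρ pk i).2 = (pkRT k ρ pk i).1 ⬝ᵥ s + (errOf k pk s + tErr k ρ pk) i := by
    intro i
    simp only [pkRT, errOf, tErr, tvec, Pi.add_apply, Pi.sub_apply]
    ring
  -- decompression adds `c_v` and `−sᵀc_u`
  have h1 : ∀ c : Cipher R k, dec k s (ctRT k ρ c) = dec k s c + vErr k ρ c - s ⬝ᵥ uErr k ρ c := by
    intro c
    simp only [dec, ctRT, vErr, uErr, dotProduct_sub]
    ring
  unfold noise ct
  rw [h1, dec_encDet k (pkRT k ρ pk) s _ hpk, add_dotProduct]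
  ring

/-! ### B. The codec criterion: decoding succeeds when the noise is good -/

/-- **Correct decryption from a decoding criterion.** If the message codec `(encode, decode)` decodes
`encode m + w` to `m` whenever the noise `w` is `good` (for Kyber: `‖w‖_∞ < ⌈q/4⌋`, Theorem 1's "then we
can write `v − sᵀu = w + ⌈q/2⌋·m` … implies `m = m′`"), then `Dec(sk, Enc(pk, m)) = m` for every key pair
and all coins whose noise is good. [cite: BosEtAl2018Kyber, §3 proof of Thm 1] -/
theorem decode_dec_ctRT_ct {M : Type} {encode : M → R} {decode : R → M} {good : R → Prop}
    (hgood : ∀ m w, good w → decode (encode m + w) = m) (ρ : RoundTrips R k) (pk : PubKey R k)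
    (s : Fin k → R) (m : M) (r e₁ : Fin k → R) (e₂ : R)
    (h : good (noise k ρ pk s (encode m) r e₁ e₂)) :
    decode (dec k s (ctRT k ρ (ct k ρ pk (encode m) r e₁ e₂))) = m := by
  rw [dec_ctRT_ct]
  exact hgood m _ h

/-- Contrapositive: a decryption error forces bad noise (the event whose probability is `δ`).
[cite: BosEtAl2018Kyber, §3 Thm 1 (δ = Pr[‖w‖_∞ ≥ ⌈q/4⌋])] -/
theorem not_good_of_decode_ne {M : Type} {encode : M → R} {decode : R → M} {good : R → Prop}
    (hgood : ∀ m w, good w → decode (encode m + w) = m) (ρ : RoundTrips R k) (pk : PubKey R k)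
    (s : Fin k → R) (m : M) (r e₁ : Fin k → R) (e₂ : R)
    (h : decode (dec k s (ctRT k ρ (ct k ρ pk (encode m) r e₁ e₂))) ≠ m) :
    ¬good (noise k ρ pk s (encode m) r e₁ e₂) :=
  fun hg ↦ h (decode_dec_ctRT_ct k hgood ρ pk s m r e₁ e₂ hg)

/-- Message-free version: if `good₀ w₀` guarantees `good (w₀ + c_v)` for every possible `c_v` (worst-case
`c_v`, Barbosa et al. §3.2.2), a decryption error forces `¬good₀(noise₀)`, an event that does not involve
the message. [cite: BarbosaEtAl2025CorrectnessBounds, §3.2.2 (removing the adversary)] -/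
theorem not_good₀_of_decode_ne {M : Type} {encode : M → R} {decode : R → M} {good good₀ : R → Prop}
    (hgood : ∀ m w, good w → decode (encode m + w) = m) (ρ : RoundTrips R k)
    (hshift : ∀ w (c : Cipher R k), good₀ w → good (w + vErr k ρ c)) (pk : PubKey R k)
    (s : Fin k → R) (m : M) (r e₁ : Fin k → R) (e₂ : R)
    (h : decode (dec k s (ctRT k ρ (ct k ρ pk (encode m) r e₁ e₂))) ≠ m) :
    ¬good₀ (noise₀ k ρ pk s r e₁ e₂) := fun h0 ↦
  not_good_of_decode_ne k hgood ρ pk s m r e₁ e₂ h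
    (by rw [noise_eq_noise₀_add]; exact hshift _ _ h0)

/-! ### C. `(1 − δ)`-correctness: the functional `E_{keys}[max_m Pr_{coins}[Dec(Enc(m)) ≠ m]]` -/

section Correctness

variable (χ₁ χ₂ : PMF R)

/-- The coins of `Enc`: `(r, e₁, e₂)` with `r ← χ₁^k`, `e₁ ← χ₂^k`, `e₂ ← χ₂` (Kyber v3.02 §1.4: `r` has
width `η₁`, `e₁, e₂` width `η₂`; one law when `χ₁ = χ₂`). [cite: BosEtAl2018Kyber, §3 Algorithm 2 (r, e₁, e₂ ← β_η)] [cite: AvanziEtAl2021KyberSpec, §1.4 p. 11 (η₁, η₂)] -/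
def coins : PMF ((Fin k → R) × (Fin k → R) × R) :=
  (LWE.iidPMF χ₁ k).bind fun r ↦ (LWE.iidPMF χ₂ k).bind fun e₁ ↦ χ₂.map fun e₂ ↦ (r, e₁, e₂)

/-- The tree's two-width encryption `KyberPKE.enc₂` with the encryptor's key `t′`, followed by the
ciphertext round trip, is the coins pushed through `ct` and `ctRT`. [cite: BosEtAl2018Kyber, §3 Algorithms 2–3] -/
theorem map_ctRT_enc₂ (ρ : RoundTrips R k) (pk : PubKey R k) (μ : R) :
    (enc₂ k χ₁ χ₂ (pkRT k ρ pk) μ).map (ctRT k ρ) =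
      (coins k χ₁ χ₂).map fun c ↦ ctRT k ρ (ct k ρ pk μ c.1 c.2.1 c.2.2) := by
  simp only [enc₂, coins, PMF.map_bind, PMF.map_comp]
  rfl

variable {M : Type} [DecidableEq M]

/-- `Pr_{coins of Enc}[Dec(sk, Enc(pk, m)) ≠ m]` for a FIXED key pair `ks = (pk, sk)` and message `m` — the
inner probability of the `δ`-correctness definition — for the scheme with message codec
`(encode, decode)` and round trips `ρ`. [cite: HofheinzHovelmannsKiltz2017, §2.1 (Pr[Dec(sk, c) ≠ m | c ← Enc(pk, m)])] [cite: BosEtAl2018Kyber, §2.1] -/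
def failProb (encode : M → R) (decode : R → M) (ρ : RoundTrips R k)
    (ks : PubKey R k × (Fin k → R)) (m : M) : ℝ≥0∞ :=
  ((coins k χ₁ χ₂).map fun c ↦
      decide (decode (dec k ks.2 (ctRT k ρ (ct k ρ ks.1 (encode m) c.1 c.2.1 c.2.2))) ≠ m)) true

/-- `failProb` is literally `Pr[decode(Dec(sk, c′)) ≠ m : c ← enc₂(pk′, encode m), c′ = round trip of c]`
with the tree's `KyberPKE.enc₂`. [cite: BosEtAl2018Kyber, §2.1 (probability over the coins of Enc)] -/
theorem failProb_eq_enc₂ (encode : M → R) (decode : R → M) (ρ : RoundTrips R k)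
    (ks : PubKey R k × (Fin k → R)) (m : M) :
    failProb k χ₁ χ₂ encode decode ρ ks m =
      ((enc₂ k χ₁ χ₂ (pkRT k ρ ks.1) (encode m)).map fun c ↦
        decide (decode (dec k ks.2 (ctRT k ρ c)) ≠ m)) true := by
  simp only [failProb, enc₂, coins, PMF.map_bind, PMF.map_comp]
  rfl

/-- **The correctness error** `δ(PKE) = E_{(pk, sk) ← KeyGen}[max_{m ∈ M} Pr_{coins}[Dec(sk, Enc(pk, m)) ≠
m]]` (HHK17 §2.1; Bos et al. §2.1 "Following [HHK17], … where the expectation is taken over `(pk, sk) ←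
KeyGen` and the probability is taken over the random coins of `Enc`"): `PKE` is `(1 − δ′)`-correct iff
`correctnessError ≤ δ′`. Keys from the tree's `KyberPKE.keyGen χ₁ k` (`s, e ← χ₁`).
[cite: HofheinzHovelmannsKiltz2017, §2.1 (δ-correct)] [cite: BosEtAl2018Kyber, §2.1 ((1−δ)-correct)] -/
def correctnessError [Fintype R] (encode : M → R) (decode : R → M) (ρ : RoundTrips R k) : ℝ≥0∞ :=
  ∑' ks, keyGen χ₁ k ks * ⨆ m : M, failProb k χ₁ χ₂ encode decode ρ ks m

/-- `Pr_{coins}[¬good(noise)]` for a fixed key pair and encoded message `μ` — the inner probability of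
Theorem 1's `δ` with the ACTUAL round-trip errors. [cite: BosEtAl2018Kyber, §3 Thm 1 (δ)] -/
def noiseFailProb (good : R → Prop) [DecidablePred good] (ρ : RoundTrips R k)
    (ks : PubKey R k × (Fin k → R)) (μ : R) : ℝ≥0∞ :=
  ((coins k χ₁ χ₂).map fun c ↦ decide ¬good (noise k ρ ks.1 ks.2 μ c.1 c.2.1 c.2.2)) true

/-- The `δ`-functional of the noise event: `E_{keys}[max_m Pr_{coins}[¬good(noise(encode m))]]`.
[cite: BosEtAl2018Kyber, §3 Thm 1 (δ)] -/
def noiseError [Fintype R] (encode : M → R) (good : R → Prop) [DecidablePred good]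
    (ρ : RoundTrips R k) : ℝ≥0∞ :=
  ∑' ks, keyGen χ₁ k ks * ⨆ m : M, noiseFailProb k χ₁ χ₂ good ρ ks (encode m)

/-- `Pr_{keys, coins}[¬good₀(noise₀)]`: the message-free event of Barbosa et al. §3.2.2 as an honest
probability (keys, then coins). [cite: BarbosaEtAl2025CorrectnessBounds, §3.2.2 (COR¹ game without the adversary)] -/
def noise₀Fail [Fintype R] (good₀ : R → Prop) [DecidablePred good₀] (ρ : RoundTrips R k) : PMF Bool :=
  (keyGen χ₁ k).bind fun ks ↦ (coins k χ₁ χ₂).map fun c ↦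
    decide ¬good₀ (noise₀ k ρ ks.1 ks.2 c.1 c.2.1 c.2.2)

omit [CommRing R] in
/-- Monotonicity of `Pr[f = true]` under implication of Boolean events. [folklore] -/
private theorem map_true_mono {α : Type} (P : PMF α) {f g : α → Bool}
    (h : ∀ a, f a = true → g a = true) : (P.map f) true ≤ (P.map g) true := by
  rw [PMF.map_apply, PMF.map_apply]
  refine ENNReal.tsum_le_tsum fun a ↦ ?_
  by_cases hf : f a = true
  · rw [if_pos hf.symm, if_pos (h a hf).symm]
  · rw [if_neg (Ne.symm hf)]
    exact zero_le

/-- **Theorem 1, inner step**: for every key pair and message, `Pr_{coins}[Dec(Enc(m)) ≠ m] ≤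
Pr_{coins}[¬good(noise(m))]`. [cite: BosEtAl2018Kyber, §3 Thm 1] -/
theorem failProb_le_noiseFailProb {encode : M → R} {decode : R → M} {good : R → Prop}
    [DecidablePred good] (hgood : ∀ m w, good w → decode (encode m + w) = m) (ρ : RoundTrips R k)
    (ks : PubKey R k × (Fin k → R)) (m : M) :
    failProb k χ₁ χ₂ encode decode ρ ks m ≤ noiseFailProb k χ₁ χ₂ good ρ ks (encode m) :=
  map_true_mono _ fun c hc ↦ by
    simp only [decide_eq_true_eq] at hc ⊢
    exact not_good_of_decode_ne k hgood ρ ks.1 ks.2 m _ _ _ hc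

/-- **Theorem 1 (`(1 − δ)`-correctness), rigorous content**: `δ(PKE) = E_{keys}[max_m Pr[Dec(Enc(m)) ≠ m]]
≤ E_{keys}[max_m Pr[¬good(noise(m))]]` — with the TRUE round-trip errors `c_t, c_u, c_v`; the printed `δ`
then replaces them by independent `ψ`-samples, a heuristic step not formalised here.
[cite: BosEtAl2018Kyber, §3 Thm 1] [cite: BarbosaEtAl2025CorrectnessBounds, §3.2.1 (the heuristic)] -/
theorem correctnessError_le_noiseError [Fintype R] {encode : M → R} {decode : R → M}
    {good : R → Prop} [DecidablePred good] (hgood : ∀ m w, good w → decode (encode m + w) = m) (ρ : RoundTrips R k) :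
    correctnessError k χ₁ χ₂ encode decode ρ ≤ noiseError k χ₁ χ₂ encode good ρ :=
  ENNReal.tsum_le_tsum fun ks ↦
    mul_le_mul_right (iSup_mono fun m ↦ failProb_le_noiseFailProb k χ₁ χ₂ hgood ρ ks m) _

/-- **Removing the maximum over messages** (Barbosa et al. §3.2.2): if `good₀ w₀ → good (w₀ + c_v)` for
every possible `c_v`, then `δ(PKE) ≤ Pr_{keys, coins}[¬good₀(noise₀)]`, a single probability.
[cite: BarbosaEtAl2025CorrectnessBounds, §3.2.2 (upper-bounding COR by the adversary-free experiment)] -/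
theorem correctnessError_le_noise₀ [Fintype R] {encode : M → R} {decode : R → M}
    {good good₀ : R → Prop} [DecidablePred good₀] (hgood : ∀ m w, good w → decode (encode m + w) = m) (ρ : RoundTrips R k)
    (hshift : ∀ w (c : Cipher R k), good₀ w → good (w + vErr k ρ c)) :
    correctnessError k χ₁ χ₂ encode decode ρ ≤ noise₀Fail k χ₁ χ₂ good₀ ρ true := by
  rw [noise₀Fail, PMF.bind_apply]
  refine ENNReal.tsum_le_tsum fun ks ↦ mul_le_mul_right (iSup_le fun m ↦ ?_) _
  exact map_true_mono _ fun c hc ↦ by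
    simp only [decide_eq_true_eq] at hc ⊢
    exact not_good₀_of_decode_ne k hgood ρ hshift ks.1 ks.2 m _ _ _ hc

end Correctness

end KyberPKE

/-! ### D. The decoding threshold in `ℤ_q`: `Compress_q(⌈q/2⌋·m + w, 1) = m` for small `w` -/

namespace MLKEM

/-- Integer division pinned by two-sided bounds. [folklore] -/
private theorem ediv_eq_of_bounds {a b c : ℤ} (hc : 0 < c) (h1 : a * c ≤ b) (h2 : b < (a + 1) * c) :
    b / c = a :=
  le_antisymm (Int.lt_add_one_iff.mp ((Int.ediv_lt_iff_lt_mul hc).mpr h2))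
    ((Int.le_ediv_iff_mul_le hc).mpr h1)

/-- `Decompress_q(m, 1) = ⌊(q·m + 1)/2⌋` on values, i.e. `0 ↦ 0`, `1 ↦ ⌈q/2⌋` (`q ≥ 2`).
[cite: BosEtAl2018Kyber, §3 proof of Thm 1 (⌈q/2⌋·m)] [cite: NISTFIPS203, §4.2.1 eq. (4.8)] -/
theorem val_decompress_one {q : ℕ} [NeZero q] (hq : 1 < q) (m : ZMod (2 ^ 1)) :
    ((decompress q 1 m).val : ℤ) = ((q : ℤ) * m.val + 1) / 2 := by
  haveI : NeZero (2 ^ 1) := ⟨by norm_num⟩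
  have hm : m.val < 2 := by simpa using ZMod.val_lt m
  rw [decompress_eq_formula, ZMod.val_intCast, decompressFormula]
  rcases Nat.lt_succ_iff_lt_or_eq.mp hm with h0 | h1
  · have h0' : m.val = 0 := by omega
    rw [h0']
    norm_num
  · rw [h1]
    have h4 : (2 * (q : ℤ) * ((1 : ℕ) : ℤ) + 2 ^ 1) / (2 * 2 ^ 1) = ((q : ℤ) * ((1 : ℕ) : ℤ) + 1) / 2 := by
      norm_num
      omega
    rw [h4]
    exact Int.emod_eq_of_lt (by push_cast; omega) (by push_cast; omega)

/-- **The decoding step of Theorem 1, every modulus `q`**: for `m ∈ {0, 1}` and `w ∈ ℤ_q` with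
`4·|w mod± q| + 2 < q`, `Compress_q(Decompress_q(m, 1) + w, 1) = m` — "we can write `v − sᵀu = w +
⌈q/2⌋·m` … [and conclude] `m = m′ = Compress_q(v − sᵀu, 1)`"; Barbosa et al.: below the threshold no
decoding error can occur. (For odd `q` the hypothesis reads `|w mod± q| < ⌈q/4⌋`,
`not_lt_iff_threshold_le`.) [cite: BosEtAl2018Kyber, §3 proof of Thm 1 (m = m′ for all odd q)] [cite: BarbosaEtAl2025CorrectnessBounds, §3.2 (⌊q/4⌋ − 1 is the maximum noise value)] -/
theorem compress_one_decompress_one_add {q : ℕ} [NeZero q] (m : ZMod (2 ^ 1)) (w : ZMod q)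
    (hw : 4 * |w.valMinAbs| + 2 < (q : ℤ)) : compress q 1 (decompress q 1 m + w) = m := by
  haveI : NeZero (2 ^ 1) := ⟨by norm_num⟩
  have hq0 : (0 : ℤ) < q := by exact_mod_cast Nat.pos_of_ne_zero (NeZero.ne q)
  have hq1 : 1 < q := by
    have := abs_nonneg w.valMinAbs
    exact_mod_cast (show (1 : ℤ) < q by linarith)
  have hm : m.val < 2 := by simpa using ZMod.val_lt m
  have hv01 : (m.val : ℤ) = 0 ∨ (m.val : ℤ) = 1 := by omega
  have hu₀q : (0 : ℤ) ≤ w.val ∧ (w.val : ℤ) < q := ⟨by positivity, by exact_mod_cast ZMod.val_lt w⟩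
  -- the centred representative of `w` in terms of `w.val`
  have hwv : (w.valMinAbs : ℤ) = if w.val ≤ q / 2 then (w.val : ℤ) else (w.val : ℤ) - q := by
    rw [ZMod.valMinAbs_def_pos]
  -- the bounds on `w.val` that the hypothesis on `w mod± q` gives
  have hsmall : (2 * (w.val : ℤ) ≤ q ∧ 4 * (w.val : ℤ) + 2 < q) ∨
      ((q : ℤ) < 2 * w.val ∧ 3 * (q : ℤ) + 2 < 4 * w.val) := by
    by_cases hle : w.val ≤ q / 2
    · rw [if_pos hle] at hwv
      left
      rw [hwv, abs_of_nonneg hu₀q.1] at hw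
      constructor <;> omega
    · rw [if_neg hle] at hwv
      right
      rw [hwv, abs_of_nonpos (by omega)] at hw
      constructor <;> omega
  -- the value of `x = Decompress(m) + w`
  have hxval : ((decompress q 1 m + w).val : ℤ) = ((((q : ℤ) * m.val + 1) / 2) + w.val) % q := by
    rw [ZMod.val_add, ← val_decompress_one hq1 m]
    push_cast
    rfl
  -- the integer identity behind `Compress_q(x, 1) = m`
  have key : (4 * ((decompress q 1 m + w).val : ℤ) + q) / (2 * q) % 2 = (m.val : ℤ) := by
    rw [hxval]
    generalize (w.val : ℤ) = u₀ at hsmall hu₀q ⊢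
    rcases hv01 with hv0 | hv1
    · -- message bit 0: `x = w`
      rw [hv0]
      have hz : ((q : ℤ) * 0 + 1) / 2 = 0 := by norm_num
      rw [hz, zero_add, Int.emod_eq_of_lt hu₀q.1 hu₀q.2]
      rcases hsmall with ⟨h1, h2⟩ | ⟨h1, h2⟩
      · rw [ediv_eq_of_bounds (a := 0) (by omega) (by omega) (by omega)]
        norm_num
      · rw [ediv_eq_of_bounds (a := 2) (by omega) (by omega) (by omega)]
        norm_num
    · -- message bit 1: `x = ⌈q/2⌋ + w`, possibly wrapped around
      rw [hv1]
      have hD : (q : ℤ) ≤ 2 * (((q : ℤ) * 1 + 1) / 2) ∧ 2 * (((q : ℤ) * 1 + 1) / 2) ≤ q + 1 := by omega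
      generalize ((q : ℤ) * 1 + 1) / 2 = D at hD ⊢
      rcases hsmall with ⟨h1, h2⟩ | ⟨h1, h2⟩
      · rw [Int.emod_eq_of_lt (a := D + u₀) (b := (q : ℤ)) (by omega) (by omega),
          ediv_eq_of_bounds (a := 1) (by omega) (by omega) (by omega)]
        norm_num
      · have hr : (D + u₀) % (q : ℤ) = D + u₀ - q := by
          rw [Int.emod_eq_sub_self_emod]
          exact Int.emod_eq_of_lt (by omega) (by omega)
        rw [hr, ediv_eq_of_bounds (a := 1) (by omega) (by omega) (by omega)]
        norm_num
  -- conclude through the integer formula for `Compress_q(·, 1)`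
  rw [compress_eq_iff_formula, compressFormula]
  simp only [pow_one, Nat.reduceMul]
  exact_mod_cast key

/-- `⌈q/4⌋` (round half up, Bos et al. §2.2) in integer arithmetic: `⌊(q + 2)/4⌋`.
[cite: BosEtAl2018Kyber, §2.2 (Rounding) and §3 Thm 1 (⌈q/4⌋)] -/
theorem round_quarter_eq (q : ℕ) : round ((q : ℚ) / 4) = ((q : ℤ) + 2) / 4 := by
  have h := round_half_eq q 1
  norm_num at h
  exact h

/-- For odd `q`, the good-noise condition `4a + 2 < q` fails exactly when `a ≥ ⌈q/4⌋ = ⌊(q + 2)/4⌋` — the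
printed threshold of Theorem 1. [cite: BosEtAl2018Kyber, §3 Thm 1 (‖w‖_∞ ≥ ⌈q/4⌋)] -/
theorem not_lt_iff_threshold_le {q : ℕ} (hq : Odd q) (a : ℕ) :
    ¬(4 * a + 2 < q) ↔ (q + 2) / 4 ≤ a := by
  obtain ⟨t, ht⟩ := hq
  omega

/-- **The threshold is sharp at ML-KEM's `q = 3329`**: with `q + 2)/4 = 832 = ⌈q/4⌋`, the noise value
`w = 832` turns the message bit `1` into `0` (`Compress_q(⌈q/2⌋ + 832, 1) = 0`); kernel-checked.
[cite: BarbosaEtAl2025CorrectnessBounds, §3.2 (⌊q/4⌋ − 1 is the MAXIMUM safe noise value)] -/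
theorem threshold_sharp_mlkem :
    (q + 2) / 4 = 832 ∧ ((832 : ZMod q)).valMinAbs = 832 ∧
      compress q 1 (decompress q 1 1 + 832) ≠ 1 := by
  refine ⟨by decide, by decide, ?_⟩
  rw [Ne, compress_eq_iff_formula, decompress_eq_formula]
  decide

/-! ### E. Coefficient-wise codec over `R_q = 𝓞_K / q` in a `ℤ`-basis, and the good-noise event -/

section Rq

open NumberField

variable {K : Type} [Field K] {n : ℕ} (b : Module.Basis (Fin n) ℤ (𝓞 K)) (q : ℕ) [NeZero q]

/-- `Decompress_q(y, d)` of a coefficient vector `y ∈ ℤ_{2^d}^n`: the element of `R_q` whose `b`-coordinates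
are `Decompress_q(yᵢ, d)` (Kyber §1.1: applied "to each coefficient individually"; companion of the tree's
`MLKEM.compressRq`). [cite: AvanziEtAl2021KyberSpec, §1.1 (Decompress applied to each coefficient)] [cite: BosEtAl2018Kyber, §2.2 (Compression and Decompression, coefficient-wise)] -/
def decompressRq (d : ℕ) (y : Fin n → ZMod (2 ^ d)) : RingLWE.Rq K q :=
  RingLWE.ofIntCoords b q fun i ↦ ((decompress q d (y i)).val : ℤ)

/-- The coordinates of `decompressRq y` are `Decompress_q(yᵢ, d)`. [cite: AvanziEtAl2021KyberSpec, §1.1] -/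
theorem rqCoords_decompressRq (d : ℕ) (y : Fin n → ZMod (2 ^ d)) :
    rqCoords b q (decompressRq b q d y) = fun i ↦ decompress q d (y i) := by
  unfold decompressRq
  rw [RingLWR.rqCoords_ofIntCoords]
  funext i
  push_cast
  exact ZMod.natCast_zmod_val _

/-- `Compress_q(Decompress_q(y, d), d) = y` coefficient-wise (`2^d < q`). [cite: NISTFIPS203, §4.2.1 (first property)] -/
theorem compressRq_decompressRq {d : ℕ} (hdq : 2 ^ d < q) (y : Fin n → ZMod (2 ^ d)) :
    compressRq b q d (decompressRq b q d y) = y := by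
  funext i
  simp only [compressRq, rqCoords_decompressRq]
  exact compress_decompress hdq (y i)

/-- The compression ROUND TRIP of width `d` on `R_q`: `x ↦ Decompress_q(Compress_q(x, d), d)`
coefficient-wise. [cite: BosEtAl2018Kyber, §3 proof of Thm 1 (y − Decompress_q(Compress_q(y, d), d))] -/
def roundTripRq (d : ℕ) (x : RingLWE.Rq K q) : RingLWE.Rq K q :=
  decompressRq b q d (compressRq b q d x)

/-- Coordinates of the round-trip error `x′ − x`: the per-coefficient compression error.
[cite: AvanziEtAl2021KyberSpec, §4.4 eq. (7)] -/
theorem rqCoords_roundTripRq_sub (d : ℕ) (x : RingLWE.Rq K q) (i : Fin n) :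
    rqCoords b q (roundTripRq b q d x - x) i =
      decompress q d (compress q d (rqCoords b q x i)) - rqCoords b q x i := by
  rw [map_sub, roundTripRq, rqCoords_decompressRq]
  rfl

/-- `‖x′ − x‖_∞ ≤ B_q = ⌈q/2^{d+1}⌋ = ⌊(q + 2^d)/2^{d+1}⌋` for the width-`d` round trip (Kyber §1.1 eq. (2),
every coefficient; `‖·‖_∞` = the tree's `RingLWE.coeffSupNorm`). [cite: AvanziEtAl2021KyberSpec, §1.1 eq. (2)] [cite: BosEtAl2018Kyber, §2.2 eq. (1) (|x′ − x mod± q| ≤ B_q)] -/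
theorem coeffSupNorm_roundTripRq_sub_le (d : ℕ) (x : RingLWE.Rq K q) :
    RingLWE.coeffSupNorm b q (roundTripRq b q d x - x) ≤ (q + 2 ^ d) / 2 ^ (d + 1) := by
  unfold RingLWE.coeffSupNorm
  refine Finset.sup_le fun i _ ↦ ?_
  rw [rqCoords_roundTripRq_sub]
  have h := abs_compressErr_le d (rqCoords b q x i)
  rw [round_half_eq] at h
  unfold compressErr at h
  have h' : (((decompress q d (compress q d (rqCoords b q x i)) - rqCoords b q x i).valMinAbs.natAbs : ℕ)
      : ℤ) ≤ ((q : ℤ) + 2 ^ d) / 2 ^ (d + 1) := by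
    rwa [Int.natCast_natAbs]
  exact_mod_cast h'

/-- **Kyber's message encoding** `m ↦ Decompress_q(m, 1) = ⌈q/2⌋·m ∈ R_q` for `m ∈ {0,1}^n` (Algorithm 5:
"`v := tᵀr + e₂ + Decompress_q(m, 1)`"; Bos et al.: `⌈q/2⌋·m`). Decoding is the tree's
`MLKEM.compressRq b q 1` (Algorithm 6: "`m := Compress_q(v − sᵀu, 1)`"). [cite: AvanziEtAl2021KyberSpec, §1 Algorithms 5–6] [cite: BosEtAl2018Kyber, §3 Algorithms 2–3] -/
def encodeMsg (m : Fin n → ZMod (2 ^ 1)) : RingLWE.Rq K q := decompressRq b q 1 m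

/-- **The good-noise event** `4‖w‖_∞ + 2 < q` (for odd `q`: `‖w‖_∞ < ⌈q/4⌋`, `not_goodNoise_iff`), with
`‖w‖_∞ = max_i |wᵢ mod± q|` the tree's `RingLWE.coeffSupNorm b q`. [cite: BosEtAl2018Kyber, §3 Thm 1 (‖w‖_∞ < ⌈q/4⌋)] -/
def GoodNoise (w : RingLWE.Rq K q) : Prop := 4 * RingLWE.coeffSupNorm b q w + 2 < q

/-- `GoodNoise` is a decidable inequality of natural numbers. [folklore] -/
instance instDecidablePredGoodNoise : DecidablePred (GoodNoise b q) := fun _ ↦ Nat.decLt _ _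

omit [NeZero q] in
/-- For odd `q`: the noise is NOT good iff `‖w‖_∞ ≥ ⌈q/4⌋ = ⌊(q + 2)/4⌋`, Theorem 1's event.
[cite: BosEtAl2018Kyber, §3 Thm 1 (‖w‖_∞ ≥ ⌈q/4⌋)] -/
theorem not_goodNoise_iff (hq : Odd q) (w : RingLWE.Rq K q) :
    ¬GoodNoise b q w ↔ (q + 2) / 4 ≤ RingLWE.coeffSupNorm b q w :=
  not_lt_iff_threshold_le hq _

/-- **Decoding below the threshold, coefficient-wise**: `Compress_q(Decompress_q(m, 1) + w, 1) = m` for every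
`m ∈ {0,1}^n` and every `w ∈ R_q` with `4‖w‖_∞ + 2 < q`. [cite: BosEtAl2018Kyber, §3 proof of Thm 1 (m = m′)] -/
theorem compressRq_one_encodeMsg_add (m : Fin n → ZMod (2 ^ 1)) (w : RingLWE.Rq K q)
    (hw : GoodNoise b q w) : compressRq b q 1 (encodeMsg b q m + w) = m := by
  funext i
  simp only [compressRq, encodeMsg, map_add, rqCoords_decompressRq, Pi.add_apply]
  apply compress_one_decompress_one_add
  have hi : ((rqCoords b q w i).valMinAbs).natAbs ≤ RingLWE.coeffSupNorm b q w :=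
    Finset.le_sup (f := fun j ↦ ((rqCoords b q w j).valMinAbs).natAbs) (Finset.mem_univ i)
  unfold GoodNoise at hw
  have habs : |(rqCoords b q w i).valMinAbs| = (((rqCoords b q w i).valMinAbs).natAbs : ℤ) :=
    (Int.natCast_natAbs _).symm
  rw [habs]
  exact_mod_cast (show 4 * ((rqCoords b q w i).valMinAbs).natAbs + 2 < q by omega)

/-- Triangle inequality for the centred representative: `|(a + b) mod± q| ≤ |a mod± q| + |b mod± q|`.
[cite: BosEtAl2018Kyber, §2.2 (Sizes of elements; triangle inequality used in the proof of Thm 1)] -/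
theorem natAbs_valMinAbs_add_le (a c : ZMod q) :
    ((a + c).valMinAbs).natAbs ≤ (a.valMinAbs).natAbs + (c.valMinAbs).natAbs := by
  have h := ZMod.natAbs_min_of_le_div_two q ((a + c).valMinAbs) (a.valMinAbs + c.valMinAbs)
    (by simp [ZMod.coe_valMinAbs])
    (ZMod.natAbs_valMinAbs_le _)
  exact h.trans (Int.natAbs_add_le _ _)

/-- `‖a + c‖_∞ ≤ ‖a‖_∞ + ‖c‖_∞`. [cite: BosEtAl2018Kyber, §2.2 (Sizes of elements)] -/
theorem coeffSupNorm_add_le (a c : RingLWE.Rq K q) :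
    RingLWE.coeffSupNorm b q (a + c) ≤ RingLWE.coeffSupNorm b q a + RingLWE.coeffSupNorm b q c := by
  unfold RingLWE.coeffSupNorm
  refine Finset.sup_le fun i _ ↦ ?_
  rw [map_add, Pi.add_apply]
  refine (natAbs_valMinAbs_add_le q _ _).trans (Nat.add_le_add ?_ ?_)
  · exact Finset.le_sup (f := fun j ↦ ((rqCoords b q a j).valMinAbs).natAbs) (Finset.mem_univ i)
  · exact Finset.le_sup (f := fun j ↦ ((rqCoords b q c j).valMinAbs).natAbs) (Finset.mem_univ i)

/-- **Kyber's / ML-KEM's round trips**: `t` exact, `u` at width `d_u` (each of the `k` entries), `v` at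
width `d_v` (Kyber v3.02 Algorithms 5–6; FIPS 203 Algorithms 14–15). [cite: AvanziEtAl2021KyberSpec, §1 Algorithm 5 ("c := (Compress_q(u, d_u), Compress_q(v, d_v))") and Algorithm 6] -/
def roundTrips (k du dv : ℕ) : KyberPKE.RoundTrips (RingLWE.Rq K q) k :=
  ⟨id, fun u j ↦ roundTripRq b q du (u j), roundTripRq b q dv⟩

/-- **Bos et al.'s original round trips** with a compressed public key (`d_t`, Algorithm 1 l. 4).
[cite: BosEtAl2018Kyber, §3 Algorithms 1–3 (d_t, d_u, d_v)] -/
def roundTripsPK (k dt du dv : ℕ) : KyberPKE.RoundTrips (RingLWE.Rq K q) k :=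
  ⟨fun t j ↦ roundTripRq b q dt (t j), fun u j ↦ roundTripRq b q du (u j), roundTripRq b q dv⟩

/-- With ML-KEM's round trips, `‖c_v‖_∞ ≤ B_{d_v} = ⌊(q + 2^{d_v})/2^{d_v+1}⌋` whatever the ciphertext.
[cite: AvanziEtAl2021KyberSpec, §1.1 eq. (2)] -/
theorem coeffSupNorm_vErr_le (k du dv : ℕ) (c : KyberPKE.Cipher (RingLWE.Rq K q) k) :
    RingLWE.coeffSupNorm b q (KyberPKE.vErr k (roundTrips b q k du dv) c) ≤ (q + 2 ^ dv) / 2 ^ (dv + 1) :=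
  coeffSupNorm_roundTripRq_sub_le b q dv c.2

/-- The message-free good event of width `d_v`: `4(‖w₀‖_∞ + B_{d_v}) + 2 < q` (worst-case `c_v`).
[cite: BarbosaEtAl2025CorrectnessBounds, §3.2.2 (threshold lowered by c_v's maximum)] -/
def GoodNoise₀ (dv : ℕ) (w : RingLWE.Rq K q) : Prop :=
  4 * (RingLWE.coeffSupNorm b q w + (q + 2 ^ dv) / 2 ^ (dv + 1)) + 2 < q

/-- `GoodNoise₀` is a decidable inequality of natural numbers. [folklore] -/
instance instDecidablePredGoodNoise₀ (dv : ℕ) : DecidablePred (GoodNoise₀ b q dv) :=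
  fun _ ↦ Nat.decLt _ _

/-- Worst-case `c_v`: `GoodNoise₀(w₀) → GoodNoise(w₀ + c_v)` for every ciphertext.
[cite: BarbosaEtAl2025CorrectnessBounds, §3.2.2] -/
theorem goodNoise_of_goodNoise₀ (k du dv : ℕ) (w : RingLWE.Rq K q)
    (c : KyberPKE.Cipher (RingLWE.Rq K q) k) (h : GoodNoise₀ b q dv w) :
    GoodNoise b q (w + KyberPKE.vErr k (roundTrips b q k du dv) c) := by
  unfold GoodNoise
  unfold GoodNoise₀ at h
  have h1 := coeffSupNorm_add_le b q w (KyberPKE.vErr k (roundTrips b q k du dv) c)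
  have h2 := coeffSupNorm_vErr_le b q k du dv c
  omega

/-! ### F. Correctness of K-PKE over `R_q` -/

/-- **K-PKE decrypts correctly whenever the noise is good** — every key pair `(pk, s)`, every message
`m ∈ {0,1}^n`, all coins `(r, e₁, e₂)`, any round trips `ρ`: `4‖w‖_∞ + 2 < q → Compress_q(v′ − sᵀu′, 1) = m`
with `w = eᵀr + e₂ + c_v − sᵀe₁ + c_tᵀr − sᵀc_u`. [cite: BosEtAl2018Kyber, §3 Thm 1 and proof] -/
theorem kpke_decode_eq (k : ℕ) (ρ : KyberPKE.RoundTrips (RingLWE.Rq K q) k)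
    (pk : KyberPKE.PubKey (RingLWE.Rq K q) k) (s : Fin k → RingLWE.Rq K q) (m : Fin n → ZMod (2 ^ 1))
    (r e₁ : Fin k → RingLWE.Rq K q) (e₂ : RingLWE.Rq K q)
    (h : GoodNoise b q (KyberPKE.noise k ρ pk s (encodeMsg b q m) r e₁ e₂)) :
    compressRq b q 1 (KyberPKE.dec k s (KyberPKE.ctRT k ρ (KyberPKE.ct k ρ pk (encodeMsg b q m) r e₁ e₂)))
      = m :=
  KyberPKE.decode_dec_ctRT_ct k (compressRq_one_encodeMsg_add b q) ρ pk s m r e₁ e₂ h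

/-- **Printed form (odd `q`)**: a decryption error forces `‖w‖_∞ ≥ ⌈q/4⌋`.
[cite: BosEtAl2018Kyber, §3 Thm 1 (δ = Pr[‖w‖_∞ ≥ ⌈q/4⌋])] -/
theorem threshold_le_coeffSupNorm_noise_of_ne (hq : Odd q) (k : ℕ)
    (ρ : KyberPKE.RoundTrips (RingLWE.Rq K q) k) (pk : KyberPKE.PubKey (RingLWE.Rq K q) k)
    (s : Fin k → RingLWE.Rq K q) (m : Fin n → ZMod (2 ^ 1)) (r e₁ : Fin k → RingLWE.Rq K q)
    (e₂ : RingLWE.Rq K q)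
    (h : compressRq b q 1
        (KyberPKE.dec k s (KyberPKE.ctRT k ρ (KyberPKE.ct k ρ pk (encodeMsg b q m) r e₁ e₂))) ≠ m) :
    (q + 2) / 4 ≤ RingLWE.coeffSupNorm b q (KyberPKE.noise k ρ pk s (encodeMsg b q m) r e₁ e₂) :=
  (not_goodNoise_iff b q hq _).mp
    (KyberPKE.not_good_of_decode_ne k (compressRq_one_encodeMsg_add b q) ρ pk s m r e₁ e₂ h)

/-- **Theorem 1 over `R_q`, `δ`-functional form**: with keys `s, e ← χ₁`, coins `r ← χ₁`, `e₁, e₂ ← χ₂`,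
messages `{0,1}^n`, Kyber's codec and any round trips,
`E_{keys}[max_m Pr_{coins}[Dec(Enc(m)) ≠ m]] ≤ E_{keys}[max_m Pr_{coins}[4‖w(m)‖_∞ + 2 ≥ q]]`.
[cite: BosEtAl2018Kyber, §3 Thm 1 ((1−δ)-correct)] -/
theorem kpke_correctnessError_le [NumberField K] (k : ℕ) (χ₁ χ₂ : PMF (RingLWE.Rq K q))
    (ρ : KyberPKE.RoundTrips (RingLWE.Rq K q) k) :
    KyberPKE.correctnessError k χ₁ χ₂ (encodeMsg b q) (compressRq b q 1) ρ ≤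
      KyberPKE.noiseError k χ₁ χ₂ (encodeMsg b q) (GoodNoise b q) ρ :=
  KyberPKE.correctnessError_le_noiseError k χ₁ χ₂ (compressRq_one_encodeMsg_add b q) ρ

/-- **Message-free bound with ML-KEM's round trips** (Barbosa et al. §3.2.2): `δ(K-PKE) ≤
Pr_{keys, coins}[4(‖w₀‖_∞ + B_{d_v}) + 2 ≥ q]`, `w₀ = eᵀr + e₂ − sᵀe₁ − sᵀc_u`.
[cite: BarbosaEtAl2025CorrectnessBounds, §3.2.2] -/
theorem kpke_correctnessError_le_noise₀ [NumberField K] (k du dv : ℕ) (χ₁ χ₂ : PMF (RingLWE.Rq K q)) :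
    KyberPKE.correctnessError k χ₁ χ₂ (encodeMsg b q) (compressRq b q 1) (roundTrips b q k du dv) ≤
      KyberPKE.noise₀Fail k χ₁ χ₂ (GoodNoise₀ b q dv) (roundTrips b q k du dv) true :=
  KyberPKE.correctnessError_le_noise₀ k χ₁ χ₂ (compressRq_one_encodeMsg_add b q) _
    (fun w c hw ↦ goodNoise_of_goodNoise₀ b q k du dv w c hw)

end Rq

/-! ### G. The ML-KEM instance: `q = 3329`, `R_q = 𝓞(ℚ(ζ_512))/q`, `D_η` noise -/

/-- `⌈q/4⌋ = ⌊(q + 2)/4⌋ = 832` and `q` is odd, for `q = 3329`. [cite: AvanziEtAl2021KyberSpec, §1.4 Table 1 (q = 3329)] -/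
theorem threshold_mlkem : (q + 2) / 4 = 832 ∧ Odd q := ⟨by decide, ⟨1664, by decide⟩⟩

/-- `B_{d_v} = 104` at `d_v = 4` (ML-KEM-512/768): the message-free event is `‖w₀‖_∞ ≥ 728`.
[cite: AvanziEtAl2021KyberSpec, §1.4 Table 1 (d_v = 4)] -/
theorem bdv_mlkem768 : (q + 2 ^ 4) / 2 ^ (4 + 1) = 104 := by decide

/-- `B_{d_v} = 52` at `d_v = 5` (ML-KEM-1024). [cite: AvanziEtAl2021KyberSpec, §1.4 Table 1 (d_v = 5)] -/
theorem bdv_mlkem1024 : (q + 2 ^ 5) / 2 ^ (5 + 1) = 52 := by decide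

open NumberField in
/-- **ML-KEM's K-PKE decrypts correctly whenever `‖w‖_∞ ≤ 831`** (every key pair, message, coins; `u`
compressed to `d_u` bits, `v` to `d_v` bits), over `R_q = 𝓞(ℚ(ζ_512))/3329` in the power basis.
[cite: BosEtAl2018Kyber, §3 Thm 1] [cite: BarbosaEtAl2025CorrectnessBounds, §3.2 (⌊q/4⌋ − 1 = 831)] -/
theorem mlkem_decode_eq (k du dv : ℕ)
    (pk : KyberPKE.PubKey (RingLWE.Rq (CyclotomicField (2 ^ 9) ℚ) q) k)
    (s : Fin k → RingLWE.Rq (CyclotomicField (2 ^ 9) ℚ) q)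
    (m : Fin (cyclotomicPowerBasis 9).dim → ZMod (2 ^ 1))
    (r e₁ : Fin k → RingLWE.Rq (CyclotomicField (2 ^ 9) ℚ) q) (e₂ : RingLWE.Rq (CyclotomicField (2 ^ 9) ℚ) q)
    (h : RingLWE.coeffSupNorm (cyclotomicPowerBasis 9).basis q
        (KyberPKE.noise k (roundTrips (cyclotomicPowerBasis 9).basis q k du dv) pk s
          (encodeMsg (cyclotomicPowerBasis 9).basis q m) r e₁ e₂) ≤ 831) :
    compressRq (cyclotomicPowerBasis 9).basis q 1
        (KyberPKE.dec k s (KyberPKE.ctRT k (roundTrips (cyclotomicPowerBasis 9).basis q k du dv)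
          (KyberPKE.ct k (roundTrips (cyclotomicPowerBasis 9).basis q k du dv) pk
            (encodeMsg (cyclotomicPowerBasis 9).basis q m) r e₁ e₂))) = m :=
  kpke_decode_eq _ q k _ pk s m r e₁ e₂ (by unfold GoodNoise; have hq : q = 3329 := rfl; omega)

open NumberField in
/-- **ML-KEM, Theorem 1 in `δ`-functional form** with the laws of FIPS 203 / Kyber §1.4 (`s, e, r ←
D_{η₁}(R_q)`, `e₁, e₂ ← D_{η₂}(R_q)`; ML-KEM-512: `(k, η₁, η₂, d_u, d_v) = (2, 3, 2, 10, 4)`, -768: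
`(3, 2, 2, 10, 4)`, -1024: `(4, 2, 2, 11, 5)`): the correctness error of K-PKE is at most
`E_{keys}[max_m Pr_{coins}[‖w(m)‖_∞ ≥ 832]]`, and (message-free) at most
`Pr_{keys, coins}[‖w₀‖_∞ + B_{d_v} ≥ 832]`. [cite: BosEtAl2018Kyber, §3 Thm 1] [cite: BarbosaEtAl2025CorrectnessBounds, §3.2.2] [cite: AvanziEtAl2021KyberSpec, §1.4 p. 11] -/
theorem mlkem_correctnessError_le (k η₁ η₂ du dv : ℕ) :
    KyberPKE.correctnessError k (RingLWE.binomialRq (cyclotomicPowerBasis 9).basis q η₁)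
        (RingLWE.binomialRq (cyclotomicPowerBasis 9).basis q η₂)
        (encodeMsg (cyclotomicPowerBasis 9).basis q) (compressRq (cyclotomicPowerBasis 9).basis q 1)
        (roundTrips (cyclotomicPowerBasis 9).basis q k du dv) ≤
      KyberPKE.noiseError k (RingLWE.binomialRq (cyclotomicPowerBasis 9).basis q η₁)
        (RingLWE.binomialRq (cyclotomicPowerBasis 9).basis q η₂)
        (encodeMsg (cyclotomicPowerBasis 9).basis q) (GoodNoise (cyclotomicPowerBasis 9).basis q)
        (roundTrips (cyclotomicPowerBasis 9).basis q k du dv) ∧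
    KyberPKE.correctnessError k (RingLWE.binomialRq (cyclotomicPowerBasis 9).basis q η₁)
        (RingLWE.binomialRq (cyclotomicPowerBasis 9).basis q η₂)
        (encodeMsg (cyclotomicPowerBasis 9).basis q) (compressRq (cyclotomicPowerBasis 9).basis q 1)
        (roundTrips (cyclotomicPowerBasis 9).basis q k du dv) ≤
      KyberPKE.noise₀Fail k (RingLWE.binomialRq (cyclotomicPowerBasis 9).basis q η₁)
        (RingLWE.binomialRq (cyclotomicPowerBasis 9).basis q η₂)
        (GoodNoise₀ (cyclotomicPowerBasis 9).basis q dv)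
        (roundTrips (cyclotomicPowerBasis 9).basis q k du dv) true :=
  ⟨kpke_correctnessError_le _ q k _ _ _, kpke_correctnessError_le_noise₀ _ q k du dv _ _⟩

end MLKEM

end Literature.Computability.Cryptography
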